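import Literature.NumberTheory.LFunctions.VinogradovKorobovClosureFord
import Literature.NumberTheory.LFunctions.ZetaArgHSW
import HarnessLib

/-!
# Discharge of Theorem 1.4 and Lemma 6.1 of Mossinghoff–Trudgian–Yang

Topic `Literature/NumberTheory/LFunctions`, family RH (explicit Vinogradov–Korobov zero-free
regions). Sibling of `VinogradovKorobov.lean`, which vendors as the NAMED FACT
`Literature.NumberTheory.LFunctions.zero_free_region_intermediate_mossinghoff_trudgian_yang`
**Theorem 1.4** of Mossinghoff–Trudgian–Yang (Res. Number Theory 10 (2024) = arXiv:2212.06867,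
p. 4): *there are no zeros of `ζ(σ + it)` for `|t| ≥ exp 1000` and
`σ > 1 − 0.05035/h(t) + 0.0349/h(t)²`, `h(t) = (27/164) log|t| + 7.096`*; and of
`VinogradovKorobovInputs.lean`, which vendors its **Lemma 6.1** (the zero inequality at
intermediate height, p. 12) as
`Literature.NumberTheory.LFunctions.zero_inequality_intermediate_mossinghoff_trudgian_yang`.
Everything in this file is PROVED; no definition, no named fact.

Both facts are now theorems of the tree:

* `Literature.NumberTheory.LFunctions.zero_free_region_intermediate_mossinghoff_trudgian_yang_holds`
  — **Theorem 1.4 as printed** (threshold `exp 1000`);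
* `Literature.NumberTheory.LFunctions.zero_inequality_intermediate_mossinghoff_trudgian_yang_holds`
  — **Lemma 6.1 as printed**.

## The proof (the printed §6, formalised across the tree)

The source proves Theorem 1.4 in §6 (pp. 12–13) from Lemma 6.1, and Lemma 6.1 from Ford's
smoothed zero detector at `η = ½` (Lemma 4.2 = Ford, *Number Theory for the Millennium II*
(2002) = arXiv:1910.08205, Lemmas 4.5–4.6), Ford's kernel (4.3)–(4.6), the trigonometric
polynomial `P₄₀`, Lemma 4.3 (= Ford's Lemma 3.4), Lemma 4.4, the `3/2`-line bound (Ford (9.1)),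
the far-zero bound (6.4) (= Ford (9.2)), and the two printed external inputs **(3.3)** (Patel's
sub-Weyl bound `|ζ(½+it)| ≤ 307.098|t|^{27/164}`) and **(3.8)** (the Riemann–von Mangoldt formula
of Hasanalizade–Shen–Wong, Corollary 1.2). In the tree:

* §6 descent Lemma 6.1 ⟹ Theorem 1.4 from a threshold, with an explicit a-priori classical
  region in place of Theorem 1.3: `VinogradovKorobovIntermediateThreshold.lean`,
  `VinogradovKorobovIntermediateDescent.lean`, `ZetaZeroFreeRegionExplicit.lean`;
* the `η = ½` assembly (6.2)–(6.9) (= Ford §9): `VinogradovKorobovIntermediateAssembly.lean`,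
  with the kernel layer `VinogradovKorobovIntermediateInputs.lean`, `VinogradovKorobovZeroDetector.lean`,
  Lemma 4.4 `VinogradovKorobovTrigIntegral.lean`, the `3/2`-line bound
  `VinogradovKorobovThreeHalvesLine.lean` (`Σ Λ(n)/(n²−n) ≤ 0.851`), the far-zero bound (6.4) from
  (3.8) `VinogradovKorobovFarZeros.lean`, Lemma 4.3 `FordLogZetaIntegralBound.lean`;
* Ford's Lemmas 2.2, 3.1–3.4, 4.1, 4.5–4.6 (the smoothed zero detector, `h42`):
  `FordZetaZeroDetector*.lean`, `FordZetaLogDerivLeftLine.lean`, `FordZetaZeroRecipSqSum.lean`,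
  `FordLemma41.lean`, `SmoothedExplicitFormula*.lean`, `FordLaplaceInversion.lean`,
  `FordExplicitFormulaError.lean`, `FordLemma45Contour.lean`, `FordLemma46.lean`,
  `FordLemma46Smoothing.lean`; closure `VinogradovKorobovClosureFord.lean`
  (`zero_free_region_intermediate_of_hsw`, `zero_inequality_intermediate_of_hsw`: both facts from
  (3.8) alone, (3.3) being the theorem `zeta_half_line_patel_holds` of
  `VinogradovKorobovInputsProofs.lean` = Patel–Yang's `ABA³B` van der Corput argument);
* (3.8) itself: `zetaZeroCount_hasanalizade_shen_wong_holds` (`ZetaArgHSW.lean`, Backlund's trick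
  and Jensen's formula as in Hasanalizade–Shen–Wong §§2–5, with `ZetaArgBacklundExplicit.lean`
  below `T₀ = 30 610 046 000`).

This file only composes the last two items.

## References

* M. J. Mossinghoff, T. S. Trudgian, A. Yang, *Explicit zero-free regions for the Riemann
  zeta-function*, Res. Number Theory 10 (2024), no. 1, Paper No. 11 = arXiv:2212.06867:
  Theorem 1.4 (p. 4), Lemma 6.1 and §6 (pp. 12–13), (3.3), (3.8).
  [cite: MossinghoffTrudgianYangRNT2024, Theorem 1.4]
* K. Ford, *Zero-free regions for the Riemann zeta function*, Number Theory for the Millennium II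
  (Urbana, IL, 2000), A K Peters 2002, 25–56 = arXiv:1910.08205: Lemmas 4.5–4.6, §9.
  [cite: Ford2002Millennium, §9]
* E. Hasanalizade, Q. Shen, P.-J. Wong, *Counting zeros of the Riemann zeta function*, J. Number
  Theory 235 (2022), 219–241, Corollary 1.2. [cite: HasanalizadeShenWong2022, Corollary 1.2]
* D. Patel, A. Yang, *An explicit sub-Weyl bound for `ζ(1/2 + it)`*, J. Number Theory 262
  (2024) = arXiv:2302.13444, (1.2). [cite: PatelYang2024, (1.2)]
-/


noncomputable section

namespace Literature.NumberTheory.LFunctions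

/-- **Lemma 6.1 of Mossinghoff–Trudgian–Yang** (the named fact
`Literature.NumberTheory.LFunctions.zero_inequality_intermediate_mossinghoff_trudgian_yang`, as
printed): the in-tree derivation from (3.8) (`zero_inequality_intermediate_of_hsw`) fed with the
in-tree proof of (3.8) (`zetaZeroCount_hasanalizade_shen_wong_holds`).
[cite: MossinghoffTrudgianYangRNT2024, Lemma 6.1] -/
theorem zero_inequality_intermediate_mossinghoff_trudgian_yang_holds :
    zero_inequality_intermediate_mossinghoff_trudgian_yang :=
  zero_inequality_intermediate_of_hsw zetaZeroCount_hasanalizade_shen_wong_holds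

/-- **Theorem 1.4 of Mossinghoff–Trudgian–Yang** (the named fact
`Literature.NumberTheory.LFunctions.zero_free_region_intermediate_mossinghoff_trudgian_yang`, as
printed, threshold `exp 1000`): there are no zeros `σ + it` of `ζ` with `|t| ≥ e^{1000}` and
`σ > 1 − 0.05035/h(t) + 0.0349/h(t)²`, `h(t) = (27/164) log|t| + 7.096`. The in-tree derivation
from (3.8) (`zero_free_region_intermediate_of_hsw`) fed with the in-tree proof of (3.8)
(`zetaZeroCount_hasanalizade_shen_wong_holds`). [cite: MossinghoffTrudgianYangRNT2024, Theorem 1.4] -/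
theorem zero_free_region_intermediate_mossinghoff_trudgian_yang_holds :
    zero_free_region_intermediate_mossinghoff_trudgian_yang :=
  zero_free_region_intermediate_of_hsw zetaZeroCount_hasanalizade_shen_wong_holds

end Literature.NumberTheory.LFunctions
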